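import Mathlib.Analysis.Calculus.IteratedDeriv.Lemmas
import Mathlib.Analysis.Calculus.ContDiff.Deriv
import Mathlib.Analysis.SpecialFunctions.SmoothTransition
import Mathlib.MeasureTheory.Integral.IntervalIntegral.IntegrationByParts
import Mathlib.MeasureTheory.Integral.DominatedConvergence
import Mathlib.Analysis.Normed.Group.Bounded
import HarnessLib

/-!
# Point values from weak bounds: the Peano-kernel identity and the estimate `‖g 0‖ ≤ C_d · A`

Topic `Literature/Analysis/Distribution`; namespace `Literature.Analysis.Distribution`. Theorems, plus
four concrete auxiliary functions with bodies (`peanoCutoff`, `peanoKernel`, `peanoStep`,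
`peanoApprox`); no named fact. Pure one-variable calculus.

Let `g` be a smooth function on `ℝ` with values in a real Banach space `E`. Suppose all that is
known about `g` is a *weak bound of order `d`* for `g` and for its `(d+2)`-nd derivative: for
every smooth real test function `η` supported in `[-1, 3]`,

  `‖∫ η • g‖ ≤ A · ‖η‖_{C^d}` and `‖∫ η • g^{(d+2)}‖ ≤ A · ‖η‖_{C^d}`,

where `‖η‖_{C^d}` is any common bound of `|η|, |η'|, …, |η^{(d)}|` (the hypotheses are spelled
out; no predicate is introduced). Then the POINT value is controlled: `‖g 0‖ ≤ C_d · A` with `C_d`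
depending on `d` alone (`exists_norm_apply_zero_le_of_weak_bounds`). This is the one-variable estimate behind
Hörmander's theorem on distributions satisfying an evolution equation in one variable (Hörmander,
ALPDO I, Thm. 4.4.8: a distribution `u` on `Y × I` with `∂_t u = a(t, x, ∂_x) u` is a `C^∞` function
of `t` with values in `𝒟'(Y)`, so that its restriction to `t = 0` exists): applied to
`t ↦ ∫ W(t, x) F(x) dx`, whose `t`-derivatives are again pairings of `W` with `x`-derivatives of
`F`, it bounds the restriction of `W` to the hypersurface `t = 0` by weak (smeared) bounds on `W`
— the form in which it is used for the restriction of Whittaker distributions to the mirabolic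
subgroup (automatic continuity of Whittaker functionals, Jacquet–Shalika (1981), Prop. (3.8)).

The mechanism is the **Peano kernel** `k_d(t) = χ(t) t^{d+1}/(d+1)!` (`χ` a smooth cut-off, `= 1`
on `(-∞, 1]`, `= 0` on `[2, ∞)`): `d + 2` integrations by parts on `[0, 3]` give the identity

  `g 0 = (-1)^d ∫₀³ k_d • g^{(d+2)} - ∫₀³ k_d^{(d+2)} • g`  (`apply_zero_eq_sub_integral_peanoKernel`),

because `k_d^{(i)}(0) = δ_{i, d+1}` and `k_d` vanishes near `3`. The second kernel `k_d^{(d+2)}` is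
smooth and supported in `[1, 2]`; the first, `k_d · 1_{[0, ∞)}`, is only `C^d`, and is approximated
by the smooth kernels `η_ε = smoothTransition(·/ε) · k_d`, whose derivatives of order `≤ d` are
bounded UNIFORMLY in `ε ∈ (0, 1/2]` (`exists_bound_iteratedDeriv_peanoApprox`: a derivative of
order `j` falling on the step costs `ε^{-j}` and is paid for by `|k_d^{(i-j)}(t)| ≤ t^{d+1-i+j}`
on its support `t ≤ ε`), while `∫ η_ε • g^{(d+2)} → ∫₀³ k_d • g^{(d+2)}` by dominated convergence.

Contents: `intervalIntegral_smul_iteratedDeriv_eq` (iterated integration by parts with all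
boundary terms), `peanoCutoff`, `peanoKernel` and their local formulas
(`iteratedDeriv_peanoKernel_of_lt_one`, `iteratedDeriv_peanoKernel_zero`,
`tsupport_iteratedDeriv_peanoKernel_add_two`), the identity
`apply_zero_eq_sub_integral_peanoKernel`, the approximants `peanoApprox` with
`exists_bound_iteratedDeriv_peanoApprox`, and the estimate `exists_norm_apply_zero_le_of_weak_bounds`.
A point `t₀ ≠ 0`, another side, or another scale are reached by composing `g` with an affine map.

## References

* L. Hörmander, *The Analysis of Linear Partial Differential Operators I*, 2nd ed., Springer
  (1990/2003), Thm. 4.4.8 and Thm. 4.4.8′ (distributions satisfying an ordinary differential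
  equation in one of the variables are smooth in that variable with values in `𝒟'`)
  [HormanderALPDO1].
* G. Peano (1913) / the Peano kernel theorem for linear functionals annihilating polynomials;
  here only the explicit truncated-power kernel is used [folklore].
-/

noncomputable section

open scoped ContDiff Topology
open _root_.MeasureTheory _root_.Filter _root_.Set intervalIntegral

namespace Literature.Analysis.Distribution

variable {E : Type*} [NormedAddCommGroup E] [NormedSpace ℝ E]

/-! ### Iterated integration by parts -/

/-- For smooth `f`, `f^{(m)}` has derivative `f^{(m+1)}` everywhere. [folklore] -/
theorem hasDerivAt_iteratedDeriv_of_contDiff {f : ℝ → E} (hf : ContDiff ℝ ∞ f) (m : ℕ) (x : ℝ) :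
    HasDerivAt (iteratedDeriv m f) (iteratedDeriv (m + 1) f x) x := by
  have hd : Differentiable ℝ (iteratedDeriv m f) :=
    hf.differentiable_iteratedDeriv m (by exact_mod_cast ENat.coe_lt_top m)
  rw [iteratedDeriv_succ]
  exact (hd x).hasDerivAt

/-- Iterated derivatives of smooth functions are smooth. [folklore] -/
theorem contDiff_iteratedDeriv_of_contDiff {f : ℝ → E} (hf : ContDiff ℝ ∞ f) (m : ℕ) :
    ContDiff ℝ ∞ (iteratedDeriv m f) := by
  rw [iteratedDeriv_eq_iterate]
  exact hf.iterate_deriv m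

/-- Iterated derivatives of smooth functions are continuous. [folklore] -/
theorem continuous_iteratedDeriv_of_contDiff {f : ℝ → E} (hf : ContDiff ℝ ∞ f) (m : ℕ) :
    Continuous (iteratedDeriv m f) :=
  hf.continuous_iteratedDeriv m (by exact_mod_cast le_top)

variable [CompleteSpace E]

/-- **Iterated integration by parts on an interval**, with all boundary terms: for smooth real `u`
and smooth vector-valued `g`,
`∫ₐᵇ u • g^{(m)} = Σ_{i<m} (-1)^i (u^{(i)}(b) • g^{(m-1-i)}(b) - u^{(i)}(a) • g^{(m-1-i)}(a)) + (-1)^m ∫ₐᵇ u^{(m)} • g`.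
[folklore] -/
theorem intervalIntegral_smul_iteratedDeriv_eq {u : ℝ → ℝ} {g : ℝ → E} (hu : ContDiff ℝ ∞ u)
    (hg : ContDiff ℝ ∞ g) (m : ℕ) (a b : ℝ) :
    ∫ x in a..b, u x • iteratedDeriv m g x =
      (∑ i ∈ Finset.range m, (-1 : ℝ) ^ i •
          (iteratedDeriv i u b • iteratedDeriv (m - 1 - i) g b -
            iteratedDeriv i u a • iteratedDeriv (m - 1 - i) g a)) +
        (-1 : ℝ) ^ m • ∫ x in a..b, iteratedDeriv m u x • g x := by
  induction m generalizing u with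
  | zero => simp
  | succ m ih =>
    -- one integration by parts: `∫ u • (g^{(m)})' = [u • g^{(m)}] - ∫ u' • g^{(m)}`
    have hparts : ∫ x in a..b, u x • iteratedDeriv (m + 1) g x =
        u b • iteratedDeriv m g b - u a • iteratedDeriv m g a -
          ∫ x in a..b, deriv u x • iteratedDeriv m g x := by
      have h1 : ∀ x ∈ uIcc a b, HasDerivAt u (deriv u x) x := fun x _ =>
        ((hu.differentiable (by simp)) x).hasDerivAt
      have h2 : ∀ x ∈ uIcc a b, HasDerivAt (iteratedDeriv m g) (iteratedDeriv (m + 1) g x) x :=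
        fun x _ => hasDerivAt_iteratedDeriv_of_contDiff hg m x
      have h3 : IntervalIntegrable (deriv u) volume a b :=
        (hu.continuous_deriv (by simp)).intervalIntegrable _ _
      have h4 : IntervalIntegrable (iteratedDeriv (m + 1) g) volume a b :=
        (continuous_iteratedDeriv_of_contDiff hg (m + 1)).intervalIntegrable _ _
      simpa using intervalIntegral.integral_smul_deriv_eq_deriv_smul h1 h2 h3 h4
    have hu' : ContDiff ℝ ∞ (deriv u) := hu.iterate_deriv 1
    have ih' := ih hu'
    -- rewrite `(deriv u)^{(i)} = u^{(i+1)}`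
    have hider : ∀ i, iteratedDeriv i (deriv u) = iteratedDeriv (i + 1) u := fun i => by
      rw [iteratedDeriv_succ']
    simp only [hider] at ih'
    rw [hparts, ih', Finset.sum_range_succ']
    have hidx : ∀ i : ℕ, m + 1 - 1 - (i + 1) = m - 1 - i := fun i => by omega
    have hidx0 : m + 1 - 1 - 0 = m := by omega
    simp only [hidx, hidx0]
    simp only [iteratedDeriv_zero, pow_zero, one_smul, pow_succ, mul_neg, mul_one, neg_smul,
      Finset.sum_neg_distrib]
    abel

/-! ### The cut-off and the Peano kernel -/

omit [CompleteSpace E] in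
/-- Locality of iterated derivatives at a point where the function is locally zero. [folklore] -/
theorem iteratedDeriv_eq_zero_of_eventuallyEq_zero {f : ℝ → ℝ} {t : ℝ} (h : f =ᶠ[𝓝 t] 0) (i : ℕ) :
    iteratedDeriv i f t = 0 := by
  rw [Filter.EventuallyEq.iteratedDeriv_eq i h]
  change iteratedDeriv i (fun _ : ℝ => (0 : ℝ)) t = 0
  rw [iteratedDeriv_const]
  simp

/-- A smooth cut-off on `ℝ`: `peanoCutoff = 1` on `(-∞, 1]`, `= 0` on `[2, ∞)`
(`1 - smoothTransition (t - 1)`). [folklore] -/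
def peanoCutoff (t : ℝ) : ℝ := 1 - Real.smoothTransition (t - 1)

/-- The cut-off is smooth. [folklore] -/
theorem peanoCutoff_contDiff : ContDiff ℝ ∞ peanoCutoff :=
  contDiff_const.sub (Real.smoothTransition.contDiff.comp (contDiff_id.sub contDiff_const))

/-- `peanoCutoff t = 1` for `t ≤ 1`. [folklore] -/
theorem peanoCutoff_of_le_one {t : ℝ} (ht : t ≤ 1) : peanoCutoff t = 1 := by
  simp [peanoCutoff, Real.smoothTransition.zero_of_nonpos (by linarith : t - 1 ≤ 0)]

/-- `peanoCutoff t = 0` for `2 ≤ t`. [folklore] -/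
theorem peanoCutoff_of_two_le {t : ℝ} (ht : 2 ≤ t) : peanoCutoff t = 0 := by
  simp [peanoCutoff, Real.smoothTransition.one_of_one_le (by linarith : 1 ≤ t - 1)]

/-- `|peanoCutoff t| ≤ 1`. [folklore] -/
theorem abs_peanoCutoff_le_one (t : ℝ) : |peanoCutoff t| ≤ 1 := by
  have h0 := Real.smoothTransition.nonneg (t - 1)
  have h1 := Real.smoothTransition.le_one (t - 1)
  rw [peanoCutoff, abs_le]
  constructor <;> linarith

/-- **The Peano kernel** of order `d`: `k_d(t) = χ(t) · t^{d+1} / (d+1)!` with `χ = peanoCutoff`; it is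
the truncated-power kernel `t₊^{d+1}/(d+1)!` of Taylor's formula, made smooth away from `0` and cut
off beyond `2`. [folklore] -/
def peanoKernel (d : ℕ) (t : ℝ) : ℝ := peanoCutoff t * (t ^ (d + 1) / (d + 1).factorial)

/-- The Peano kernel is smooth on `ℝ`. [folklore] -/
theorem peanoKernel_contDiff (d : ℕ) : ContDiff ℝ ∞ (peanoKernel d) :=
  peanoCutoff_contDiff.mul ((contDiff_id.pow _).div_const _)

/-- `k_d(t) = 0` for `2 ≤ t`. [folklore] -/
theorem peanoKernel_of_two_le (d : ℕ) {t : ℝ} (ht : 2 ≤ t) : peanoKernel d t = 0 := by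
  simp [peanoKernel, peanoCutoff_of_two_le ht]

/-- `k_d(t) = t^{d+1}/(d+1)!` for `t ≤ 1`. [folklore] -/
theorem peanoKernel_of_le_one (d : ℕ) {t : ℝ} (ht : t ≤ 1) :
    peanoKernel d t = t ^ (d + 1) / (d + 1).factorial := by
  simp [peanoKernel, peanoCutoff_of_le_one ht]

/-- `|k_d(t)| ≤ |t|^{d+1}/(d+1)!` everywhere. [folklore] -/
theorem abs_peanoKernel_le (d : ℕ) (t : ℝ) :
    |peanoKernel d t| ≤ |t| ^ (d + 1) / (d + 1).factorial := by
  rw [peanoKernel, abs_mul, abs_div, abs_pow, Nat.abs_cast]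
  calc |peanoCutoff t| * (|t| ^ (d + 1) / (d + 1).factorial)
      ≤ 1 * (|t| ^ (d + 1) / (d + 1).factorial) := by
        gcongr
        exact abs_peanoCutoff_le_one t
    _ = _ := one_mul _

/-- Near any `t < 1` the Peano kernel is the monomial `s ↦ s^{d+1}/(d+1)!`. [folklore] -/
theorem peanoKernel_eventuallyEq_monomial (d : ℕ) {t : ℝ} (ht : t < 1) :
    peanoKernel d =ᶠ[𝓝 t] fun s => s ^ (d + 1) / ((d + 1).factorial : ℝ) := by
  filter_upwards [Iio_mem_nhds ht] with s hs
  exact peanoKernel_of_le_one d (le_of_lt hs)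

/-- Near any `t > 2` the Peano kernel vanishes identically. [folklore] -/
theorem peanoKernel_eventuallyEq_zero (d : ℕ) {t : ℝ} (ht : 2 < t) :
    peanoKernel d =ᶠ[𝓝 t] 0 := by
  filter_upwards [Ioi_mem_nhds ht] with s hs
  exact peanoKernel_of_two_le d (le_of_lt hs)

/-- **Derivatives of the Peano kernel left of `1`**:
`k_d^{(i)}(t) = (d+1)(d)⋯(d+2-i) · t^{d+1-i} / (d+1)!` for `t < 1`. [folklore] -/
theorem iteratedDeriv_peanoKernel_of_lt_one (d : ℕ) {t : ℝ} (ht : t < 1) (i : ℕ) :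
    iteratedDeriv i (peanoKernel d) t =
      ((d + 1).descFactorial i : ℝ) * t ^ (d + 1 - i) / ((d + 1).factorial : ℝ) := by
  rw [Filter.EventuallyEq.iteratedDeriv_eq i (peanoKernel_eventuallyEq_monomial d ht),
    iteratedDeriv_div_const, iteratedDeriv_pow]

/-- `k_d^{(i)}(t) = 0` for `t > 2`. [folklore] -/
theorem iteratedDeriv_peanoKernel_of_two_lt (d : ℕ) {t : ℝ} (ht : 2 < t) (i : ℕ) :
    iteratedDeriv i (peanoKernel d) t = 0 :=
  iteratedDeriv_eq_zero_of_eventuallyEq_zero (peanoKernel_eventuallyEq_zero d ht) i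

/-- **Boundary values at `0`**: `k_d^{(i)}(0) = δ_{i, d+1}`. [folklore] -/
theorem iteratedDeriv_peanoKernel_zero (d i : ℕ) :
    iteratedDeriv i (peanoKernel d) 0 = if i = d + 1 then 1 else 0 := by
  rw [iteratedDeriv_peanoKernel_of_lt_one d zero_lt_one i]
  split_ifs with h
  · subst h
    rw [Nat.descFactorial_self, Nat.sub_self, pow_zero, mul_one, div_self]
    exact_mod_cast (Nat.factorial_pos _).ne'
  · rcases lt_or_gt_of_ne h with hi | hi
    · have : d + 1 - i ≠ 0 := by omega
      rw [zero_pow this, mul_zero, zero_div]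
    · rw [(Nat.descFactorial_eq_zero_iff_lt).2 hi]
      simp

/-- The `(d+2)`-nd derivative of `k_d` vanishes left of `1` (there `k_d` is a polynomial of degree
`d+1`). [folklore] -/
theorem iteratedDeriv_peanoKernel_add_two_of_lt_one (d : ℕ) {t : ℝ} (ht : t < 1) :
    iteratedDeriv (d + 2) (peanoKernel d) t = 0 := by
  rw [iteratedDeriv_peanoKernel_of_lt_one d ht,
    (Nat.descFactorial_eq_zero_iff_lt).2 (by omega : d + 1 < d + 2)]
  simp

/-- The smooth kernel `k_d^{(d+2)}` is supported in `[1, 2]`. [folklore] -/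
theorem tsupport_iteratedDeriv_peanoKernel_add_two (d : ℕ) :
    tsupport (iteratedDeriv (d + 2) (peanoKernel d)) ⊆ Icc 1 2 := by
  apply closure_minimal _ isClosed_Icc
  intro t ht
  rw [Function.mem_support] at ht
  by_contra h
  rw [mem_Icc, not_and_or, not_le, not_le] at h
  rcases h with h | h
  · exact ht (iteratedDeriv_peanoKernel_add_two_of_lt_one d h)
  · exact ht (iteratedDeriv_peanoKernel_of_two_lt d h _)

/-! ### The Peano identity -/

/-- **The Peano-kernel identity.** For smooth `g` with values in a Banach space,
`g 0 = (-1)^d ∫₀³ k_d • g^{(d+2)} - ∫₀³ k_d^{(d+2)} • g`: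
integrate by parts `d + 2` times; all boundary terms at `3` vanish (`k_d ≡ 0` near `3`) and at `0`
only `k_d^{(d+1)}(0) g(0) = g(0)` survives. [folklore] -/
theorem apply_zero_eq_sub_integral_peanoKernel (d : ℕ) {g : ℝ → E} (hg : ContDiff ℝ ∞ g) :
    g 0 = (-1 : ℝ) ^ d • (∫ t in (0 : ℝ)..3, peanoKernel d t • iteratedDeriv (d + 2) g t) -
      ∫ t in (0 : ℝ)..3, iteratedDeriv (d + 2) (peanoKernel d) t • g t := by
  have H := intervalIntegral_smul_iteratedDeriv_eq (peanoKernel_contDiff d) hg (d + 2) 0 3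
  have hsum : (∑ i ∈ Finset.range (d + 2), (-1 : ℝ) ^ i •
      (iteratedDeriv i (peanoKernel d) 3 • iteratedDeriv (d + 2 - 1 - i) g 3 -
        iteratedDeriv i (peanoKernel d) 0 • iteratedDeriv (d + 2 - 1 - i) g 0)) =
      (-1 : ℝ) ^ d • g 0 := by
    have h3 : ∀ i, iteratedDeriv i (peanoKernel d) 3 = 0 := fun i =>
      iteratedDeriv_peanoKernel_of_two_lt d (by norm_num) i
    simp only [h3, zero_smul, zero_sub, iteratedDeriv_peanoKernel_zero, ite_smul, one_smul,
      zero_smul, smul_neg]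
    rw [Finset.sum_eq_single (d + 1)]
    · simp only [if_true, show d + 2 - 1 - (d + 1) = 0 by omega, iteratedDeriv_zero, pow_succ,
        mul_neg, mul_one, neg_smul, neg_neg]
    · intro i _ hi
      simp [hi]
    · intro h
      exact absurd (Finset.mem_range.2 (by omega)) h
  rw [hsum] at H
  -- `H : ∫ k • g^{(d+2)} = (-1)^d • g 0 + (-1)^(d+2) • ∫ k^{(d+2)} • g`
  have h1 : ((-1 : ℝ) ^ d * (-1 : ℝ) ^ d) = 1 := by
    rw [← pow_add, ← two_mul, pow_mul]
    norm_num
  have h2 : ((-1 : ℝ) ^ d * (-1 : ℝ) ^ (d + 2)) = 1 := by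
    rw [← pow_add, show d + (d + 2) = 2 * (d + 1) by ring, pow_mul]
    norm_num
  have := congrArg (fun v => (-1 : ℝ) ^ d • v) H
  simp only [smul_add, smul_smul, h1, h2, one_smul] at this
  rw [this]
  abel

/-! ### Smooth approximants of the truncated kernel `k_d · 1_{[0, ∞)}` with uniform `C^d` bounds -/

/-- Positive-order derivatives of `smoothTransition` vanish left of `0` (all orders). [folklore] -/
theorem iteratedDeriv_smoothTransition_of_lt_zero {x : ℝ} (hx : x < 0) (j : ℕ) :
    iteratedDeriv j Real.smoothTransition x = 0 := by
  apply iteratedDeriv_eq_zero_of_eventuallyEq_zero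
  filter_upwards [Iio_mem_nhds hx] with y hy
  exact Real.smoothTransition.zero_of_nonpos (le_of_lt hy)

/-- Positive-order derivatives of `smoothTransition` vanish right of `1`. [folklore] -/
theorem iteratedDeriv_smoothTransition_of_one_lt {x : ℝ} (hx : 1 < x) {j : ℕ} (hj : j ≠ 0) :
    iteratedDeriv j Real.smoothTransition x = 0 := by
  have h : Real.smoothTransition =ᶠ[𝓝 x] fun _ => (1 : ℝ) := by
    filter_upwards [Ioi_mem_nhds hx] with y hy
    exact Real.smoothTransition.one_of_one_le (le_of_lt hy)
  rw [Filter.EventuallyEq.iteratedDeriv_eq j h, iteratedDeriv_const, if_neg hj]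

/-- Every derivative of `smoothTransition` is bounded on `ℝ`. [folklore] -/
theorem exists_bound_iteratedDeriv_smoothTransition (j : ℕ) :
    ∃ M : ℝ, 0 ≤ M ∧ ∀ x, |iteratedDeriv j Real.smoothTransition x| ≤ M := by
  rcases Nat.eq_zero_or_pos j with rfl | hj
  · refine ⟨1, zero_le_one, fun x => ?_⟩
    rw [iteratedDeriv_zero, abs_le]
    exact ⟨by linarith [Real.smoothTransition.nonneg x], Real.smoothTransition.le_one x⟩
  · have hc : Continuous (iteratedDeriv j Real.smoothTransition) :=
      Real.smoothTransition.contDiff.continuous_iteratedDeriv j (by exact_mod_cast le_top)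
    have hsupp : HasCompactSupport (iteratedDeriv j Real.smoothTransition) := by
      refine HasCompactSupport.intro (K := Icc (0 : ℝ) 1) isCompact_Icc fun x hx => ?_
      rw [mem_Icc, not_and_or, not_le, not_le] at hx
      rcases hx with hx | hx
      · exact iteratedDeriv_smoothTransition_of_lt_zero hx j
      · exact iteratedDeriv_smoothTransition_of_one_lt hx hj.ne'
    obtain ⟨C, hC⟩ := hc.bounded_above_of_compact_support hsupp
    refine ⟨max C 0, le_max_right _ _, fun x => ?_⟩
    have := hC x
    rw [Real.norm_eq_abs] at this
    exact this.trans (le_max_left _ _)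

/-- The rescaled smooth step `t ↦ smoothTransition (t / ε)`. [folklore] -/
def peanoStep (ε : ℝ) (t : ℝ) : ℝ := Real.smoothTransition (ε⁻¹ * t)

/-- The rescaled step is smooth. [folklore] -/
theorem peanoStep_contDiff (ε : ℝ) : ContDiff ℝ ∞ (peanoStep ε) :=
  Real.smoothTransition.contDiff.comp (contDiff_const.mul contDiff_id)

/-- Chain rule for the rescaled step: `(S(·/ε))^{(j)}(t) = ε^{-j} S^{(j)}(t/ε)`. [folklore] -/
theorem iteratedDeriv_peanoStep (ε : ℝ) (j : ℕ) (t : ℝ) :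
    iteratedDeriv j (peanoStep ε) t = ε⁻¹ ^ j * iteratedDeriv j Real.smoothTransition (ε⁻¹ * t) := by
  have h := iteratedDeriv_comp_const_mul (n := j) (f := Real.smoothTransition)
    Real.smoothTransition.contDiff ε⁻¹
  exact congrFun h t

/-- **The smooth approximants** `η_ε = smoothTransition(·/ε) · k_d` of the truncated Peano kernel
`k_d · 1_{[0,∞)}`. [folklore] -/
def peanoApprox (d : ℕ) (ε : ℝ) : ℝ → ℝ := peanoStep ε * peanoKernel d

/-- Pointwise formula for the approximants. [folklore] -/
theorem peanoApprox_apply (d : ℕ) (ε t : ℝ) :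
    peanoApprox d ε t = Real.smoothTransition (ε⁻¹ * t) * peanoKernel d t := rfl

/-- The approximants are smooth. [folklore] -/
theorem peanoApprox_contDiff (d : ℕ) (ε : ℝ) : ContDiff ℝ ∞ (peanoApprox d ε) :=
  (peanoStep_contDiff ε).mul (peanoKernel_contDiff d)

/-- `η_ε(t) = 0` for `t ≤ 0` (`ε > 0`). [folklore] -/
theorem peanoApprox_of_nonpos (d : ℕ) {ε t : ℝ} (hε : 0 < ε) (ht : t ≤ 0) :
    peanoApprox d ε t = 0 := by
  rw [peanoApprox_apply, Real.smoothTransition.zero_of_nonpos, zero_mul]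
  exact mul_nonpos_of_nonneg_of_nonpos (inv_nonneg.2 hε.le) ht

/-- `η_ε(t) = 0` for `t ≥ 2`. [folklore] -/
theorem peanoApprox_of_two_le (d : ℕ) (ε : ℝ) {t : ℝ} (ht : 2 ≤ t) : peanoApprox d ε t = 0 := by
  rw [peanoApprox_apply, peanoKernel_of_two_le d ht, mul_zero]

/-- `η_ε = k_d` on `[ε, ∞)` (`ε > 0`). [folklore] -/
theorem peanoApprox_of_le (d : ℕ) {ε t : ℝ} (hε : 0 < ε) (ht : ε ≤ t) :
    peanoApprox d ε t = peanoKernel d t := by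
  rw [peanoApprox_apply, Real.smoothTransition.one_of_one_le, one_mul]
  rw [← inv_mul_cancel₀ hε.ne']
  exact mul_le_mul_of_nonneg_left ht (inv_nonneg.2 hε.le)

/-- `|η_ε| ≤ |k_d|`. [folklore] -/
theorem abs_peanoApprox_le (d : ℕ) (ε t : ℝ) : |peanoApprox d ε t| ≤ |peanoKernel d t| := by
  rw [peanoApprox_apply, abs_mul]
  have h : |Real.smoothTransition (ε⁻¹ * t)| ≤ 1 := by
    rw [abs_le]
    exact ⟨by linarith [Real.smoothTransition.nonneg (ε⁻¹ * t)], Real.smoothTransition.le_one _⟩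
  calc |Real.smoothTransition (ε⁻¹ * t)| * |peanoKernel d t| ≤ 1 * |peanoKernel d t| := by
        gcongr
    _ = _ := one_mul _

/-- The approximants are supported in `[0, 2]`. [folklore] -/
theorem tsupport_peanoApprox_subset (d : ℕ) {ε : ℝ} (hε : 0 < ε) :
    tsupport (peanoApprox d ε) ⊆ Icc 0 2 := by
  apply closure_minimal _ isClosed_Icc
  intro t ht
  rw [Function.mem_support] at ht
  by_contra h
  rw [mem_Icc, not_and_or, not_le, not_le] at h
  rcases h with h | h
  · exact ht (peanoApprox_of_nonpos d hε h.le)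
  · exact ht (peanoApprox_of_two_le d ε h.le)

/-- Derivatives of `η_ε` vanish left of `0`. [folklore] -/
theorem iteratedDeriv_peanoApprox_of_lt_zero (d : ℕ) {ε t : ℝ} (hε : 0 < ε) (ht : t < 0) (i : ℕ) :
    iteratedDeriv i (peanoApprox d ε) t = 0 := by
  apply iteratedDeriv_eq_zero_of_eventuallyEq_zero
  filter_upwards [Iio_mem_nhds ht] with s hs
  exact peanoApprox_of_nonpos d hε (le_of_lt hs)

/-- Derivatives of `η_ε` vanish right of `2`. [folklore] -/
theorem iteratedDeriv_peanoApprox_of_two_lt (d : ℕ) (ε : ℝ) {t : ℝ} (ht : 2 < t) (i : ℕ) :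
    iteratedDeriv i (peanoApprox d ε) t = 0 := by
  apply iteratedDeriv_eq_zero_of_eventuallyEq_zero
  filter_upwards [Ioi_mem_nhds ht] with s hs
  exact peanoApprox_of_two_le d ε (le_of_lt hs)

/-- **Uniform `C^d` bounds for the approximants.** There is `K = K(d)` with
`|η_ε^{(i)}(t)| ≤ K` for all `0 < ε ≤ 1/2`, all `i ≤ d` and all `t`: by the Leibniz rule, a term in
which `j ≥ 1` derivatives fall on the step `smoothTransition(·/ε)` is `O(ε^{-j})`, is supported in
`t ≤ ε`, and is multiplied by `k_d^{(i-j)}(t) = O(t^{d+1-i+j}) = O(ε^{d+1-i+j})`, so it is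
`O(ε^{d+1-i}) = O(1)`. [folklore] -/
theorem exists_bound_iteratedDeriv_peanoApprox (d : ℕ) :
    ∃ K : ℝ, 0 ≤ K ∧ ∀ ε : ℝ, 0 < ε → ε ≤ 1 / 2 →
      ∀ i ≤ d, ∀ t : ℝ, |iteratedDeriv i (peanoApprox d ε) t| ≤ K := by
  -- bounds `M j` for the derivatives of the step
  choose M hM0 hM using exists_bound_iteratedDeriv_smoothTransition
  -- bounds `N m` for the derivatives of the kernel on `[0, 2]`
  have hN : ∀ m : ℕ, ∃ Nm : ℝ, 0 ≤ Nm ∧ ∀ t ∈ Icc (0 : ℝ) 2,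
      |iteratedDeriv m (peanoKernel d) t| ≤ Nm := by
    intro m
    have hc : Continuous (iteratedDeriv m (peanoKernel d)) :=
      (peanoKernel_contDiff d).continuous_iteratedDeriv m (by exact_mod_cast le_top)
    obtain ⟨C, hC⟩ := isCompact_Icc.exists_bound_of_continuousOn hc.continuousOn
    refine ⟨max C 0, le_max_right _ _, fun t ht => ?_⟩
    have := hC t ht
    rw [Real.norm_eq_abs] at this
    exact this.trans (le_max_left _ _)
  choose N hN0 hN using hN
  -- the constants `c m = (d+1)(d)⋯/(d+1)!` of the exact formula left of `1`
  set c : ℕ → ℝ := fun m => ((d + 1).descFactorial m : ℝ) / ((d + 1).factorial : ℝ) with hc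
  have hc0 : ∀ m, 0 ≤ c m := fun m => by positivity
  have hterm0 : ∀ i j : ℕ, 0 ≤ (i.choose j : ℝ) * (M j * (c (i - j) + N (i - j))) := by
    intro i j
    have := hM0 j; have := hc0 (i - j); have := hN0 (i - j)
    positivity
  -- the bound
  refine ⟨∑ i ∈ Finset.range (d + 1), ∑ j ∈ Finset.range (i + 1),
      (i.choose j : ℝ) * (M j * (c (i - j) + N (i - j))), ?_, ?_⟩
  · exact Finset.sum_nonneg fun i _ => Finset.sum_nonneg fun j _ => hterm0 i j
  intro ε hε hε2 i hi t
  have hε1 : ε ≤ 1 := hε2.trans (by norm_num)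
  -- the `i`-th inner sum bounds the `i`-th derivative; it is at most the double sum
  have hinner_le : (∑ j ∈ Finset.range (i + 1), (i.choose j : ℝ) * (M j * (c (i - j) + N (i - j)))) ≤
      ∑ i ∈ Finset.range (d + 1), ∑ j ∈ Finset.range (i + 1),
        (i.choose j : ℝ) * (M j * (c (i - j) + N (i - j))) :=
    Finset.single_le_sum (f := fun i => ∑ j ∈ Finset.range (i + 1),
        (i.choose j : ℝ) * (M j * (c (i - j) + N (i - j))))
      (fun i _ => Finset.sum_nonneg fun j _ => hterm0 i j)
      (Finset.mem_range.2 (Nat.lt_succ_of_le hi))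
  refine le_trans ?_ hinner_le
  -- outside `[0, 2]` the derivative vanishes
  by_cases ht0 : t < 0
  · rw [iteratedDeriv_peanoApprox_of_lt_zero d hε ht0 i, abs_zero]
    exact Finset.sum_nonneg fun j _ => hterm0 i j
  by_cases ht2 : 2 < t
  · rw [iteratedDeriv_peanoApprox_of_two_lt d ε ht2 i, abs_zero]
    exact Finset.sum_nonneg fun j _ => hterm0 i j
  push Not at ht0 ht2
  have htI : t ∈ Icc (0 : ℝ) 2 := ⟨ht0, ht2⟩
  -- Leibniz rule
  have hleib : iteratedDeriv i (peanoApprox d ε) t = ∑ j ∈ Finset.range (i + 1),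
      (i.choose j : ℝ) * iteratedDeriv j (peanoStep ε) t * iteratedDeriv (i - j) (peanoKernel d) t := by
    rw [peanoApprox]
    exact iteratedDeriv_mul ((peanoStep_contDiff ε).contDiffAt.of_le (by exact_mod_cast le_top))
      ((peanoKernel_contDiff d).contDiffAt.of_le (by exact_mod_cast le_top))
  rw [hleib]
  refine (Finset.abs_sum_le_sum_abs _ _).trans (Finset.sum_le_sum fun j hj => ?_)
  rw [abs_mul, abs_mul, Nat.abs_cast, mul_assoc]
  refine mul_le_mul_of_nonneg_left ?_ (Nat.cast_nonneg _)
  -- the term-wise bound `|S_ε^{(j)}(t)| · |k^{(i-j)}(t)| ≤ M j · (c (i-j) + N (i-j))`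
  rw [iteratedDeriv_peanoStep]
  rcases Nat.eq_zero_or_pos j with rfl | hjpos
  · -- no derivative on the step: `|S| ≤ M 0`, `|k^{(i)}| ≤ N i ≤ c i + N i`
    rw [pow_zero, one_mul, Nat.sub_zero]
    refine mul_le_mul (hM 0 _) ((hN i t htI).trans ?_) (abs_nonneg _) (hM0 0)
    linarith [hc0 i]
  · by_cases htε : ε < t
    · -- right of `ε` the step is constant: the term vanishes
      have h1 : 1 < ε⁻¹ * t := by
        rw [← inv_mul_cancel₀ hε.ne']
        exact mul_lt_mul_of_pos_left htε (inv_pos.2 hε)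
      rw [iteratedDeriv_smoothTransition_of_one_lt h1 hjpos.ne', mul_zero, abs_zero, zero_mul]
      have := hM0 j; have := hc0 (i - j); have := hN0 (i - j)
      positivity
    · -- on `[0, ε]`
      push Not at htε
      have ht1 : t < 1 := by linarith
      have hij : j ≤ i := Nat.lt_succ_iff.mp (Finset.mem_range.mp hj)
      have hk : |iteratedDeriv (i - j) (peanoKernel d) t| = c (i - j) * t ^ (d + 1 - (i - j)) := by
        rw [iteratedDeriv_peanoKernel_of_lt_one d ht1, hc]
        simp only
        rw [abs_div, abs_mul, Nat.abs_cast, Nat.abs_cast, abs_pow, abs_of_nonneg ht0]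
        ring
      have hstep : |ε⁻¹ ^ j * iteratedDeriv j Real.smoothTransition (ε⁻¹ * t)| ≤ ε⁻¹ ^ j * M j := by
        rw [abs_mul, abs_pow, abs_of_nonneg (inv_nonneg.2 hε.le)]
        exact mul_le_mul_of_nonneg_left (hM j _) (pow_nonneg (inv_nonneg.2 hε.le) _)
      have hpow : ε⁻¹ ^ j * t ^ (d + 1 - (i - j)) ≤ 1 := by
        have h1 : t ^ (d + 1 - (i - j)) ≤ ε ^ (d + 1 - (i - j)) :=
          pow_le_pow_left₀ ht0 htε _
        have h2 : ε ^ (d + 1 - (i - j)) ≤ ε ^ j :=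
          pow_le_pow_of_le_one hε.le hε1 (by omega)
        calc ε⁻¹ ^ j * t ^ (d + 1 - (i - j)) ≤ ε⁻¹ ^ j * ε ^ j :=
              mul_le_mul_of_nonneg_left (h1.trans h2) (pow_nonneg (inv_nonneg.2 hε.le) _)
          _ = 1 := by rw [← mul_pow, inv_mul_cancel₀ hε.ne', one_pow]
      rw [hk]
      calc |ε⁻¹ ^ j * iteratedDeriv j Real.smoothTransition (ε⁻¹ * t)| *
            (c (i - j) * t ^ (d + 1 - (i - j)))
          ≤ (ε⁻¹ ^ j * M j) * (c (i - j) * t ^ (d + 1 - (i - j))) :=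
            mul_le_mul_of_nonneg_right hstep (mul_nonneg (hc0 _) (pow_nonneg ht0 _))
        _ = M j * c (i - j) * (ε⁻¹ ^ j * t ^ (d + 1 - (i - j))) := by ring
        _ ≤ M j * c (i - j) * 1 :=
            mul_le_mul_of_nonneg_left hpow (mul_nonneg (hM0 j) (hc0 _))
        _ ≤ M j * (c (i - j) + N (i - j)) := by
            rw [mul_one, mul_add]
            linarith [mul_nonneg (hM0 j) (hN0 (i - j))]

/-! ### The point-value estimate -/

omit [CompleteSpace E] in
/-- Iterated derivatives of a compactly supported function are compactly supported (a private copy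
of `ConvolutionPowerBumps.hasCompactSupport_iteratedDeriv`, to keep the imports light). [folklore] -/
private theorem hasCompactSupport_iteratedDeriv_peano {f : ℝ → ℝ} (hf : HasCompactSupport f) (i : ℕ) :
    HasCompactSupport (iteratedDeriv i f) := by
  induction i with
  | zero => simpa [iteratedDeriv_zero] using hf
  | succ i ih =>
    rw [iteratedDeriv_succ]
    exact ih.deriv

/-- The smooth kernel `k_d^{(d+2)}` and its derivatives of order `≤ d` are bounded by a constant
depending only on `d`. [folklore] -/
theorem exists_bound_iteratedDeriv_iteratedDeriv_peanoKernel (d : ℕ) :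
    ∃ K' : ℝ, 0 ≤ K' ∧ ∀ i ≤ d, ∀ t : ℝ,
      |iteratedDeriv i (iteratedDeriv (d + 2) (peanoKernel d)) t| ≤ K' := by
  have hsm : ContDiff ℝ ∞ (iteratedDeriv (d + 2) (peanoKernel d)) :=
    contDiff_iteratedDeriv_of_contDiff (peanoKernel_contDiff d) (d + 2)
  have hsupp : HasCompactSupport (iteratedDeriv (d + 2) (peanoKernel d)) :=
    HasCompactSupport.of_support_subset_isCompact isCompact_Icc
      ((subset_tsupport _).trans (tsupport_iteratedDeriv_peanoKernel_add_two d))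
  have hi : ∀ i : ℕ, ∃ C : ℝ, 0 ≤ C ∧ ∀ t : ℝ,
      |iteratedDeriv i (iteratedDeriv (d + 2) (peanoKernel d)) t| ≤ C := by
    intro i
    have hc : Continuous (iteratedDeriv i (iteratedDeriv (d + 2) (peanoKernel d))) :=
      hsm.continuous_iteratedDeriv i (by exact_mod_cast le_top)
    have hcs : HasCompactSupport (iteratedDeriv i (iteratedDeriv (d + 2) (peanoKernel d))) :=
      hasCompactSupport_iteratedDeriv_peano hsupp i
    obtain ⟨C, hC⟩ := hc.bounded_above_of_compact_support hcs
    refine ⟨max C 0, le_max_right _ _, fun t => ?_⟩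
    have := hC t
    rw [Real.norm_eq_abs] at this
    exact this.trans (le_max_left _ _)
  choose C hC0 hC using hi
  refine ⟨∑ i ∈ Finset.range (d + 1), C i, Finset.sum_nonneg fun i _ => hC0 i, fun i hi t => ?_⟩
  exact (hC i t).trans (Finset.single_le_sum (fun j _ => hC0 j) (Finset.mem_range.2 (Nat.lt_succ_of_le hi)))

/-- **Point values from weak bounds (the one-variable estimate behind Hörmander's Thm. 4.4.8).**
For every `d` there is a constant `C = C(d) ≥ 0` such that: if `g : ℝ → E` is smooth and, for every
smooth real test function `η` supported in `[-1, 3]` and every common bound `B` of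
`|η|, …, |η^{(d)}|`, both `‖∫ η • g‖ ≤ A · B` and `‖∫ η • g^{(d+2)}‖ ≤ A · B` hold, then
`‖g 0‖ ≤ C · A`. Proof: the Peano identity `g 0 = (-1)^d ∫₀³ k_d • g^{(d+2)} - ∫₀³ k_d^{(d+2)} • g`;
the second integral is a pairing with the smooth test function `k_d^{(d+2)}` (supported in `[1,2]`),
the first is the limit of the pairings with the smooth approximants `η_{1/(n+2)}` of the truncated
kernel, whose `C^d` norms are uniformly bounded, by dominated convergence.
[cite: HormanderALPDO1, Thm. 4.4.8] -/
theorem exists_norm_apply_zero_le_of_weak_bounds (d : ℕ) :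
    ∃ C : ℝ, 0 ≤ C ∧ ∀ (g : ℝ → E), ContDiff ℝ ∞ g → ∀ A : ℝ,
      (∀ η : ℝ → ℝ, ContDiff ℝ ∞ η → tsupport η ⊆ Icc (-1) 3 →
          ∀ B : ℝ, (∀ i ≤ d, ∀ t, |iteratedDeriv i η t| ≤ B) → ‖∫ t, η t • g t‖ ≤ A * B) →
      (∀ η : ℝ → ℝ, ContDiff ℝ ∞ η → tsupport η ⊆ Icc (-1) 3 →
          ∀ B : ℝ, (∀ i ≤ d, ∀ t, |iteratedDeriv i η t| ≤ B) →
            ‖∫ t, η t • iteratedDeriv (d + 2) g t‖ ≤ A * B) →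
      ‖g 0‖ ≤ C * A := by
  obtain ⟨K, hK0, hK⟩ := exists_bound_iteratedDeriv_peanoApprox d
  obtain ⟨K', hK'0, hK'⟩ := exists_bound_iteratedDeriv_iteratedDeriv_peanoKernel d
  refine ⟨K + K', add_nonneg hK0 hK'0, fun g hg A h0 h2 => ?_⟩
  set G : ℝ → E := iteratedDeriv (d + 2) g with hGdef
  have hGc : Continuous G := continuous_iteratedDeriv_of_contDiff hg (d + 2)
  set I₁ : E := ∫ t in (0 : ℝ)..3, peanoKernel d t • G t with hI₁
  set I₂ : E := ∫ t in (0 : ℝ)..3, iteratedDeriv (d + 2) (peanoKernel d) t • g t with hI₂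
  have hid : g 0 = (-1 : ℝ) ^ d • I₁ - I₂ := apply_zero_eq_sub_integral_peanoKernel d hg
  -- the second term: a pairing with the smooth compactly supported kernel `k_d^{(d+2)}`
  have hI₂_le : ‖I₂‖ ≤ A * K' := by
    have hsub : Function.support (fun t => iteratedDeriv (d + 2) (peanoKernel d) t • g t) ⊆
        Ioc (0 : ℝ) 3 := by
      refine (Function.support_smul_subset_left _ _).trans ?_
      refine (subset_tsupport _).trans ((tsupport_iteratedDeriv_peanoKernel_add_two d).trans ?_)
      exact Icc_subset_Ioc_iff (by norm_num) |>.2 ⟨by norm_num, by norm_num⟩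
    rw [hI₂, intervalIntegral.integral_eq_integral_of_support_subset hsub]
    exact h0 _ (contDiff_iteratedDeriv_of_contDiff (peanoKernel_contDiff d) (d + 2))
      ((tsupport_iteratedDeriv_peanoKernel_add_two d).trans (Icc_subset_Icc (by norm_num) (by norm_num)))
      K' hK'
  -- the first term: dominated convergence along `ε_n = 1/(n+2)`
  have hI₁_le : ‖I₁‖ ≤ A * K := by
    set ε : ℕ → ℝ := fun n => 1 / ((n : ℝ) + 2) with hε
    have hεpos : ∀ n, 0 < ε n := fun n => by positivity
    have hεle : ∀ n, ε n ≤ 1 / 2 := fun n =>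
      one_div_le_one_div_of_le (by norm_num) (by linarith [(Nat.cast_nonneg n : (0 : ℝ) ≤ n)])
    set F : ℕ → ℝ → E := fun n t => peanoApprox d (ε n) t • G t with hF
    set f : ℝ → E := Set.indicator (Ioi 0) (fun t => peanoKernel d t • G t) with hf
    -- each smeared pairing is bounded by `A * K`
    have hFn : ∀ n, ‖∫ t, F n t‖ ≤ A * K := fun n =>
      h2 _ (peanoApprox_contDiff d (ε n))
        ((tsupport_peanoApprox_subset d (hεpos n)).trans (Icc_subset_Icc (by norm_num) (by norm_num)))
        K (fun i hi t => hK (ε n) (hεpos n) (hεle n) i hi t)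
    -- dominated convergence
    have hlim : Tendsto (fun n => ∫ t, F n t) atTop (𝓝 (∫ t, f t)) := by
      refine tendsto_integral_of_dominated_convergence
        (Set.indicator (Icc (0 : ℝ) 2) (fun t => |peanoKernel d t| * ‖G t‖)) ?_ ?_ ?_ ?_
      · intro n
        exact (((peanoApprox_contDiff d (ε n)).continuous).smul hGc).aestronglyMeasurable
      · rw [integrable_indicator_iff measurableSet_Icc]
        exact (((peanoKernel_contDiff d).continuous.abs).mul hGc.norm).integrableOn_Icc
      · intro n
        refine Eventually.of_forall fun t => ?_
        by_cases ht : t ∈ Icc (0 : ℝ) 2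
        · rw [Set.indicator_of_mem ht, hF]
          simp only [norm_smul, Real.norm_eq_abs]
          exact mul_le_mul_of_nonneg_right (abs_peanoApprox_le d _ t) (norm_nonneg _)
        · have h0 : peanoApprox d (ε n) t = 0 := by
            rw [mem_Icc, not_and_or, not_le, not_le] at ht
            rcases ht with ht | ht
            · exact peanoApprox_of_nonpos d (hεpos n) ht.le
            · exact peanoApprox_of_two_le d _ ht.le
          rw [hF]
          simp only [h0, zero_smul, norm_zero]
          exact Set.indicator_nonneg (fun s _ => mul_nonneg (abs_nonneg _) (norm_nonneg _)) t
      · refine Eventually.of_forall fun t => ?_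
        by_cases ht : 0 < t
        · -- eventually `ε_n ≤ t`, where `η_{ε_n}(t) = k_d(t)`
          rw [hf, Set.indicator_of_mem (mem_Ioi.2 ht)]
          apply tendsto_const_nhds.congr'
          obtain ⟨N, hN⟩ := exists_nat_gt (1 / t)
          filter_upwards [eventually_ge_atTop N] with n hn
          have hεt : ε n ≤ t := by
            rw [hε]
            simp only
            rw [div_le_iff₀ (by positivity)]
            have h1 : 1 / t < (n : ℝ) + 2 := by
              calc 1 / t < N := hN
                _ ≤ n := by exact_mod_cast hn
                _ ≤ (n : ℝ) + 2 := by linarith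
            have := (div_lt_iff₀ ht).1 h1
            linarith
          rw [hF]
          simp only [peanoApprox_of_le d (hεpos n) hεt]
        · rw [hf, Set.indicator_of_notMem (by simpa using ht)]
          apply tendsto_const_nhds.congr'
          refine Eventually.of_forall fun n => ?_
          rw [hF]
          simp only [peanoApprox_of_nonpos d (hεpos n) (not_lt.1 ht), zero_smul]
    -- identify the limit with `I₁`
    have hfI : ∫ t, f t = I₁ := by
      rw [hf, MeasureTheory.integral_indicator measurableSet_Ioi, hI₁, intervalIntegral.integral_of_le (by norm_num)]
      refine setIntegral_eq_of_subset_of_forall_sdiff_eq_zero measurableSet_Ioi Ioc_subset_Ioi_self ?_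
      intro t ht
      have h3 : 3 < t := by
        rcases ht with ⟨h1, h2⟩
        rw [mem_Ioc, not_and_or, not_lt, not_le] at h2
        rcases h2 with h2 | h2
        · exact absurd h1 (not_lt.2 h2)
        · exact h2
      simp [peanoKernel_of_two_le d (by linarith : (2 : ℝ) ≤ t)]
    rw [← hfI]
    exact le_of_tendsto' hlim.norm hFn
  -- conclusion
  calc ‖g 0‖ = ‖(-1 : ℝ) ^ d • I₁ - I₂‖ := by rw [hid]
    _ ≤ ‖(-1 : ℝ) ^ d • I₁‖ + ‖I₂‖ := norm_sub_le _ _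
    _ = ‖I₁‖ + ‖I₂‖ := by rw [norm_smul, norm_pow, norm_neg, norm_one, one_pow, one_mul]
    _ ≤ A * K + A * K' := add_le_add hI₁_le hI₂_le
    _ = (K + K') * A := by ring

end Literature.Analysis.Distribution
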